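import Summits.QuantumFields.YangMills.Theorems.BalabanUVNodesN15CovariantLandauLeibnizTranspose
import Summits.QuantumFields.YangMills.Theorems.BalabanUVNodesN15CovariantLandauNeumannRows
import HarnessLib

/-!
# Route «BalabanUVNodes», node N15 = NE2, road (c) — PROGRAMME (P-S), XIX: THE GLOBAL ROW OF THE COVARIANT `G′(T)` FROM THE TWO FLAT ROWS `G′(1)`, `G′(1)∂ᵀ` AND THE TRANSPORTER
# LETTERS ONLY — NO DISPLAYED GRADIENT ROW (the Calderón–Zygmund word `G′(1)Bᵀ∂` handled by the transposed Leibniz rule of n15-c∕227; improves n15-c∕215 `hasMaj_cGreen_of_flat`, which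
# needed `∂G′(1)` and `D_TG′(T) − ∂G′(1)`) (dag-n15-c g23, n15-c∕228; HOME HANDOFF «BRICK D», file D1)

Cell `pub-ymgap`, seat `pub-ymgap-dag-n15-c` (generation g23; R134 (a), s1; HUMAN RULING D-0062; chair R424 venue).  `bears_on: R4∕N15 · K3⁸ SpineGivenEndpointR13SepCoPHV
(stmt-QuantumFields-27366)`; filed `--supports stmt-QuantumFields-27366 --as helper` — COUNT-NEUTRAL.  Theorems only; 0 `sorry`.  Imports BY NAME n15-c∕224 (`claplA_one_sub_claplA`,
`cgrad_one_sub_cgrad_mulVec`), 225 (`bMulShift`, `bMulShift_mulVec_eq`, `sDiag`, `bDiv`), 227 (`bMulShift_transpose_mulVec_cgrad_one`, transposed rows' pattern), 215 (`hasMaj_cgrad_sub`,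
`hasMaj_cgrad_sub_transpose`, `hasMaj_csavg_sub(_transpose)`, `hasMaj_csavg(_transpose)`, `stair_one_cols`, `mulVecLin_sub'∕smul'`), 205 (`cGreen_sub`), lit-balaban∕b11 (`neumann_majorant`,
`hasMaj_comp_exp`), n15-c∕213 (`hasMaj_comp_localRight`), n15-a (`exists_const_hasMaj_ofBlocks`, `hasMaj_smul_ofBlocks`).  Nothing in the tree is modified.

WHY.  `G′(T) = G′(1) + G′(1)·(Δ′(1) − Δ′(T))·G′(T)` (205 `cGreen_sub`), `Δ′(1) − Δ′(T) = ∂ᵀB + Bᵀ∂ − BᵀB + a(Q₁ᵀQ₁ − Q_TᵀQ_T)`, `B = ∂ − D_T = 𝔇_W S`, `W = n(1 − T)` (224).  The four words of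
`K′ = G′(1)(Δ′(1) − Δ′(T))` have n-uniform sup-block rows WITHOUT any gradient of a propagator beyond the flat adjoint `G′(1)∂ᵀ`: `[G′(1)∂ᵀ]·B`, `G′(1)·Bᵀ∂ = G′(1)·𝔰_{V′} − [G′(1)∂ᵀ]·ℭ_Wᵀ`
(227), `G′(1)·Bᵀ·B`, and the averaging words of 215.  Neumann (`neumann_majorant`) then gives the row of `G′(T)` with constant `C_G(1 − θc)⁻¹`, `θ = O(r)` in the letters `nρ`, `n²λ`, `σ`, `τ`.
* §1 `cgrad_one_sub_eq_bMulShift` (`B = 𝔇_W S`), `hasMaj_sDiag_if`, `hasMaj_bContr_transpose_if`, `cols_bDiv_le`; §2 ★★★ **`hasMaj_cGreen_of_flat'`**.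

HONEST FRAMING ∕ LIMITS.  Bookkeeping; the flat rows `C_G`, `C_A` are HYPOTHESES here (theorems on King's torus family by n15-c∕220); MODEL carriers; NOT [Balaban1985BackgroundPropagators]
Lemma 3.3 ∕ Thm 3.4 as printed; NE2⁺ NOT PRINTED; N15 of record untouched (DISCHARGED AS CONSUMED, p687738); counts UNMOVED (typed 28∕28 · discharged 8∕27); one finite 𝕋⁴ at fixed ε per
index — NOT infinite volume ∕ OS ∕ mass gap ∕ Clay.  Restate-immune (no Theses import).
-/

noncomputable section

open scoped BigOperators Matrix
open Finset

namespace Summit.QuantumFields.YangMills.BalabanUVNodes.N15.CovLandau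

open Literature.MathematicalPhysics.QuantumFieldTheory.Balaban1983to89
open Literature.MathematicalPhysics.QuantumFieldTheory.Balaban1983to89.B5Prop11Plancherel (Tor fine unitVec)
open Literature.MathematicalPhysics.QuantumFieldTheory.Balaban1983to89.B11SectG (BlockNorm HasMaj RowSum hasMaj_comp_exp neumann_majorant)
open Literature.MathematicalPhysics.QuantumFieldTheory.Balaban1983to89.B6UnitTorusCarrier (unitTorusGeo rowSum_unitTorusGeo triangle254_unitTorusGeo unitTorusGeo_dist_nonneg)
open Literature.MathematicalPhysics.QuantumFieldTheory.Balaban1983to89.T4EtaRateCoeffDefect (fibre mem_fibre)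
open Literature.MathematicalPhysics.QuantumFieldTheory.King1986.Torus (blockOf tdistT tdistT_nonneg tdistT_symm tdistT_self)
open Summit.QuantumFields.YangMills.BalabanUVNodes.N15.MatrixSpecies (liftBlk)
open Summit.QuantumFields.YangMills.BalabanUVNodes.N15.CovAvg (cvaStair cvaStair_one)
open Summit.QuantumFields.YangMills.BalabanUVNodes.N15.BackgroundModel (kappa_ofBlocks)
open Summit.QuantumFields.YangMills.BalabanUVNodes.N15.DerivDefect (exists_const_hasMaj_ofBlocks)
open Summit.QuantumFields.YangMills.BalabanUVNodes.N15.TwoGrid (hasMaj_smul_ofBlocks)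
open Summit.QuantumFields.YangMills.BalabanUVNodes.N15.BlockRows (hasMaj_mulVecLin_of_sum_abs_le hasMaj_comp_localRight)

variable {d : ℕ}

section Green

variable (M : Fin (d + 1) → ℕ) [∀ μ, NeZero (M μ)] (n : ℕ) [NeZero n] {ι : Type} [Fintype ι] [DecidableEq ι] (L k : ℕ)

/-! ## §1 `B = 𝔇_W S` as a matrix; block-diagonal (`if`) forms of two local rows; the column letter of `div_n W` -/

/-- `∂ − D_T = 𝔇_W S` with `W = n(1 − T)`, as matrices. [cite: Balaban1985BackgroundPropagators, (3.21) p.394] -/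
theorem cgrad_one_sub_eq_bMulShift (T : Fin (d + 1) → Tor (fine n M) → Matrix ι ι ℝ) :
    (cgrad M n (fun (_ : Fin (d + 1)) (_ : Tor (fine n M)) => (1 : Matrix ι ι ℝ))) - cgrad M n T = bMulShift M n (fun ν x => (n : ℝ) • ((1 : Matrix ι ι ℝ) - T ν x)) := by
  refine eq_of_mulVec_eq' fun f => ?_
  rw [cgrad_one_sub_cgrad_mulVec, bMulShift_mulVec_eq]
  funext p
  obtain ⟨⟨x, ν⟩, i⟩ := p
  simp only [Pi.smul_apply, smul_eq_mul, bDiag_mulVec, bShift_mulVec, Matrix.smul_apply, Finset.mul_sum, mul_assoc]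

/-- `𝔰_V` in block-diagonal form: majorant `𝟙[y = y′]·v`. [folklore] -/
theorem hasMaj_sDiag_if (V : Tor (fine n M) → Matrix ι ι ℝ) {v : ℝ} (hv0 : 0 ≤ v) (hv : ∀ z i, ∑ j, |V z i j| ≤ v) :
    HasMaj (BlockNorm.ofBlocks (unitTorusGeo L k M) (liftBlk (blockOf n M) ι)) (BlockNorm.ofBlocks (unitTorusGeo L k M) (liftBlk (blockOf n M) ι)) (Matrix.mulVecLin (sDiag M n V)) (fun y y' => if y = y' then v else 0) := by
  classical
  refine hasMaj_mulVecLin_of_sum_abs_le _ _ (fun y y' => by positivity) fun q w' => ?_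
  change ∑ q' ∈ fibre (liftBlk (blockOf n M) ι) w', |sDiag M n V q q'| ≤ if blockOf n M q.1 = w' then v else 0
  by_cases hb : blockOf n M q.1 = w'
  · rw [if_pos hb]
    exact (Finset.sum_le_univ_sum_of_nonneg fun q' => abs_nonneg _).trans (sDiag_row_le M n V hv q)
  · rw [if_neg hb]
    refine le_of_eq (Finset.sum_eq_zero fun q' hq => ?_)
    have hq1 : blockOf n M q'.1 = w' := (mem_fibre (liftBlk (blockOf n M) ι) w' q').1 hq
    have : ¬ q'.1 = q.1 := fun h => hb (by rw [← h]; exact hq1)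
    simp [sDiag, this]

/-- `ℭ_Wᵀ` in block-diagonal form: majorant `𝟙[y = y′]·w′`. [folklore] -/
theorem hasMaj_bContr_transpose_if (W : Fin (d + 1) → Tor (fine n M) → Matrix ι ι ℝ) {w' : ℝ} (hw0 : 0 ≤ w') (hw : ∀ μ x i, ∑ j, |W μ x j i| ≤ w') :
    HasMaj (BlockNorm.ofBlocks (unitTorusGeo L k M) (liftBlk (blockOf n M) ι)) (BlockNorm.ofBlocks (unitTorusGeo L k M) (liftBlk (fun b : Tor (fine n M) × Fin (d + 1) => blockOf n M b.1) ι)) (Matrix.mulVecLin (bContr M n W)ᵀ) (fun y y' => if y = y' then w' else 0) := by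
  classical
  refine hasMaj_mulVecLin_of_sum_abs_le _ _ (fun y y' => by positivity) fun p w'' => ?_
  change ∑ q ∈ fibre (liftBlk (blockOf n M) ι) w'', |(bContr M n W)ᵀ p q| ≤ if blockOf n M p.1.1 = w'' then w' else 0
  by_cases hb : blockOf n M p.1.1 = w''
  · rw [if_pos hb]
    exact (Finset.sum_le_univ_sum_of_nonneg fun q => abs_nonneg _).trans (bContr_transpose_row_le M n W hw p)
  · rw [if_neg hb]
    refine le_of_eq (Finset.sum_eq_zero fun q hq => ?_)
    have hq1 : blockOf n M q.1 = w'' := (mem_fibre (liftBlk (blockOf n M) ι) w'' q).1 hq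
    have : ¬ p.1.1 = q.1 := fun h => hb (by rw [h]; exact hq1)
    simp [bContr, Matrix.transpose_apply, this]

omit [∀ μ, NeZero (M μ)] [NeZero n] [DecidableEq ι] in
/-- the COLUMN letter of the lattice divergence: `Σ_j |(div_n W)(z)_{ji}| ≤ (d+1)·n·λ′` for the column-Lipschitz letter `λ′` of `W`. [folklore] -/
theorem cols_bDiv_le (W : Fin (d + 1) → Tor (fine n M) → Matrix ι ι ℝ) {lam : ℝ} (hlam : ∀ μ z i, ∑ j, |(W μ (z - unitVec (fine n M) μ) - W μ z) j i| ≤ lam) (z : Tor (fine n M)) (i : ι) :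
    ∑ j, |(bDiv M n W z)ᵀ i j| ≤ ((d : ℝ) + 1) * (n : ℝ) * lam := by
  have hn : (0 : ℝ) ≤ n := Nat.cast_nonneg n
  calc ∑ j, |(bDiv M n W z)ᵀ i j| = ∑ j, |∑ μ, (n : ℝ) * (W μ (z - unitVec (fine n M) μ) - W μ z) j i| := by
        refine Finset.sum_congr rfl fun j _ => ?_
        simp only [Matrix.transpose_apply, bDiv, Matrix.sum_apply, Matrix.smul_apply, smul_eq_mul]
    _ ≤ ∑ j, ∑ μ, (n : ℝ) * |(W μ (z - unitVec (fine n M) μ) - W μ z) j i| :=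
        Finset.sum_le_sum fun j _ => (Finset.abs_sum_le_sum_abs _ _).trans (le_of_eq (Finset.sum_congr rfl fun μ _ => by rw [abs_mul, abs_of_nonneg hn]))
    _ = ∑ μ, (n : ℝ) * ∑ j, |(W μ (z - unitVec (fine n M) μ) - W μ z) j i| := by rw [Finset.sum_comm]; simp only [Finset.mul_sum]
    _ ≤ ∑ _μ : Fin (d + 1), (n : ℝ) * lam := Finset.sum_le_sum fun μ _ => mul_le_mul_of_nonneg_left (hlam μ z i) hn
    _ = ((d : ℝ) + 1) * (n : ℝ) * lam := by rw [Finset.sum_const, Finset.card_univ, Fintype.card_fin, nsmul_eq_mul]; push_cast; ring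

/-! ## §2 The row of `G′(T)` -/

set_option maxHeartbeats 1000000 in
/-- ★★★ **THE GLOBAL ROW OF THE COVARIANT `G′(T)` FROM `G′(1)`, `G′(1)∂ᵀ` AND THE TRANSPORTER LETTERS ONLY.**  Letters: `ρ` (entry rows∕columns of `T − 1`), `λ′` (COLUMN Lipschitz letter of `T`
along its own direction: `Σ_j|(T_μ(z) − T_μ(z − e_μ))_{ji}| ≤ λ′`), `σ, τ` (staircases, as 215); flat rows `G′(1) ≤ C_Ge^{−δd}`, `G′(1)∂ᵀ ≤ C_Ae^{−δd}`; smallness `θ·c < 1` with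
`θ = C_A(nρe^{δ})c + C_G(d+1)n(nλ′) + C_A(nρ) + C_G(n(d+1)ρe^{δ+s})(nρe^{δ+s})c² + |a|n^{−(d+1)}C_G(στ + σ)`.  Then `G′(T) ≤ C_G(1 − θc)⁻¹e^{−(δ−2s)d}`.
[cite: Balaban1985BackgroundPropagators, Thm 3.1 (3.42) p.397 (shape), (3.21)–(3.25) p.394, (3.58)–(3.62) p.402; Balaban1985Variational, (187)–(190) p.308 (Neumann)] -/
theorem hasMaj_cGreen_of_flat' {T : Fin (d + 1) → Tor (fine n M) → Matrix ι ι ℝ} (hT : ∀ ν x, IsUnit (T ν x)) {a : ℝ} (ha : 0 < a)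
    {δ s c CG CA ρ lam σ τ : ℝ} (hs : 0 < s) (hsδ : 2 * s ≤ δ) (hrow : RowSum (unitTorusGeo L k M) s c) (hc : 0 ≤ c)
    (hCG : 0 ≤ CG) (hCA : 0 ≤ CA) (hρ0 : 0 ≤ ρ) (hlam0 : 0 ≤ lam) (hσ0 : 0 ≤ σ) (hτ0 : 0 ≤ τ)
    (hρr : ∀ ν x i, ∑ j, |(T ν x - (fun (_ : Fin (d + 1)) (_ : Tor (fine n M)) => (1 : Matrix ι ι ℝ)) ν x) i j| ≤ ρ)
    (hρc : ∀ ν x j, ∑ i, |(T ν x - (fun (_ : Fin (d + 1)) (_ : Tor (fine n M)) => (1 : Matrix ι ι ℝ)) ν x) i j| ≤ ρ)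
    (hlamc : ∀ μ (z : Tor (fine n M)) i, ∑ j, |(T μ z - T μ (z - unitVec (fine n M) μ)) j i| ≤ lam)
    (hσr : ∀ y a' i, ∑ j, |(cvaStair M n (fun μ b => T μ b.1) y a' 0 - cvaStair M n (fun μ b => (fun (_ : Fin (d + 1)) (_ : Tor (fine n M)) => (1 : Matrix ι ι ℝ)) μ b.1) y a' 0) i j| ≤ σ)
    (hσc : ∀ y a' j, ∑ i, |(cvaStair M n (fun μ b => T μ b.1) y a' 0 - cvaStair M n (fun μ b => (fun (_ : Fin (d + 1)) (_ : Tor (fine n M)) => (1 : Matrix ι ι ℝ)) μ b.1) y a' 0) i j| ≤ σ)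
    (hτr : ∀ y a' i, ∑ j, |cvaStair M n (fun μ b => T μ b.1) y a' 0 i j| ≤ τ)
    (hG1 : HasMaj (BlockNorm.ofBlocks (unitTorusGeo L k M) (liftBlk (blockOf n M) ι)) (BlockNorm.ofBlocks (unitTorusGeo L k M) (liftBlk (blockOf n M) ι)) (Matrix.mulVecLin (cGreen M n (fun (_ : Fin (d + 1)) (_ : Tor (fine n M)) => (1 : Matrix ι ι ℝ)) a)) (fun y y' => CG * Real.exp (-(δ * tdistT M y y'))))
    (hA1 : HasMaj (BlockNorm.ofBlocks (unitTorusGeo L k M) (liftBlk (fun b : Tor (fine n M) × Fin (d + 1) => blockOf n M b.1) ι)) (BlockNorm.ofBlocks (unitTorusGeo L k M) (liftBlk (blockOf n M) ι)) (Matrix.mulVecLin ((cGreen M n (fun (_ : Fin (d + 1)) (_ : Tor (fine n M)) => (1 : Matrix ι ι ℝ)) a) * (cgrad M n (fun (_ : Fin (d + 1)) (_ : Tor (fine n M)) => (1 : Matrix ι ι ℝ)))ᵀ)) (fun y y' => CA * Real.exp (-(δ * tdistT M y y'))))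
    (hq : (CA * ((n : ℝ) * ρ * Real.exp δ) * c + CG * (((d : ℝ) + 1) * (n : ℝ) * ((n : ℝ) * lam)) + CA * ((n : ℝ) * ρ)
        + CG * (((n : ℝ) * ((d + 1 : ℕ) * ρ) * Real.exp (δ + s)) * ((n : ℝ) * ρ * Real.exp (δ + s)) * c) * c + |a| * (((n : ℝ) ^ (d + 1))⁻¹ * CG * (σ * τ + σ))) * c < 1) :
    HasMaj (BlockNorm.ofBlocks (unitTorusGeo L k M) (liftBlk (blockOf n M) ι)) (BlockNorm.ofBlocks (unitTorusGeo L k M) (liftBlk (blockOf n M) ι)) (Matrix.mulVecLin (cGreen M n T a))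
      (fun y y' => CG * (1 - (CA * ((n : ℝ) * ρ * Real.exp δ) * c + CG * (((d : ℝ) + 1) * (n : ℝ) * ((n : ℝ) * lam)) + CA * ((n : ℝ) * ρ)
        + CG * (((n : ℝ) * ((d + 1 : ℕ) * ρ) * Real.exp (δ + s)) * ((n : ℝ) * ρ * Real.exp (δ + s)) * c) * c + |a| * (((n : ℝ) ^ (d + 1))⁻¹ * CG * (σ * τ + σ))) * c)⁻¹ *
        Real.exp (-((δ - 2 * s) * tdistT M y y'))) := by
  have hn : (0 : ℝ) < (n : ℝ) ^ (d + 1) := pow_pos (Nat.cast_pos.mpr (Nat.pos_of_ne_zero (NeZero.ne n))) _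
  have hn1 : (0 : ℝ) ≤ (n : ℝ) := Nat.cast_nonneg n
  have hδ : 0 ≤ δ := by linarith
  have htri := triangle254_unitTorusGeo L k M
  have hd := unitTorusGeo_dist_nonneg L k M
  have h1unit : ∀ (ν : Fin (d + 1)) (x : Tor (fine n M)), IsUnit ((fun (_ : Fin (d + 1)) (_ : Tor (fine n M)) => (1 : Matrix ι ι ℝ)) ν x) := fun _ _ => isUnit_one
  have hκS : (BlockNorm.ofBlocks (unitTorusGeo L k M) (liftBlk (blockOf n M) ι)).κ = 1 := kappa_ofBlocks _
  have hκV : (BlockNorm.ofBlocks (unitTorusGeo L k M) (liftBlk (fun b : Tor (fine n M) × Fin (d + 1) => blockOf n M b.1) ι)).κ = 1 := kappa_ofBlocks _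
  have hκC : (BlockNorm.ofBlocks (unitTorusGeo L k M) (liftBlk (fun y : Tor M => y) ι)).κ = 1 := kappa_ofBlocks _
  -- local rows
  have hDD := hasMaj_cgrad_sub M n L k T hρ0 hδ hρr
  have hDDs := hasMaj_cgrad_sub M n L k T hρ0 (by linarith : 0 ≤ δ + s) hρr
  have hDDts := hasMaj_cgrad_sub_transpose M n L k T hρ0 (by linarith : 0 ≤ δ + s) hρc
  have hQQ := hasMaj_csavg_sub M n L k T hσ0 hσr
  have hQQt := hasMaj_csavg_sub_transpose M n L k T hσ0 hσc
  have hQ := hasMaj_csavg M n L k T hτ0 hτr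
  have hQ1t := hasMaj_csavg_transpose M n L k (fun (_ : Fin (d + 1)) (_ : Tor (fine n M)) => (1 : Matrix ι ι ℝ)) zero_le_one (stair_one_cols M n)
  -- the letters of `W = n(1 − T)`
  have hWc : ∀ μ x i, ∑ j, |(fun ν x => (n : ℝ) • ((1 : Matrix ι ι ℝ) - T ν x)) μ x j i| ≤ (n : ℝ) * ρ := by
    intro μ x i
    have h := hρc μ x i
    calc ∑ j, |(fun ν x => (n : ℝ) • ((1 : Matrix ι ι ℝ) - T ν x)) μ x j i| = (n : ℝ) * ∑ j, |(T μ x - (fun (_ : Fin (d + 1)) (_ : Tor (fine n M)) => (1 : Matrix ι ι ℝ)) μ x) j i| := by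
          rw [Finset.mul_sum]; refine Finset.sum_congr rfl fun j _ => ?_
          simp only [Matrix.smul_apply, smul_eq_mul, abs_mul, abs_of_nonneg hn1, Matrix.sub_apply, Matrix.one_apply]
          rw [abs_sub_comm]
      _ ≤ (n : ℝ) * ρ := mul_le_mul_of_nonneg_left h hn1
  have hWlam : ∀ μ (z : Tor (fine n M)) i, ∑ j, |((fun ν x => (n : ℝ) • ((1 : Matrix ι ι ℝ) - T ν x)) μ (z - unitVec (fine n M) μ) - (fun ν x => (n : ℝ) • ((1 : Matrix ι ι ℝ) - T ν x)) μ z) j i| ≤ (n : ℝ) * lam := by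
    intro μ z i
    have h := hlamc μ z i
    calc ∑ j, |((fun ν x => (n : ℝ) • ((1 : Matrix ι ι ℝ) - T ν x)) μ (z - unitVec (fine n M) μ) - (fun ν x => (n : ℝ) • ((1 : Matrix ι ι ℝ) - T ν x)) μ z) j i| = (n : ℝ) * ∑ j, |(T μ z - T μ (z - unitVec (fine n M) μ)) j i| := by
          rw [Finset.mul_sum]; refine Finset.sum_congr rfl fun j _ => ?_
          simp only [Matrix.smul_apply, smul_eq_mul, Matrix.sub_apply]
          rw [← mul_sub, abs_mul, abs_of_nonneg hn1, sub_sub_sub_cancel_left]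
      _ ≤ (n : ℝ) * lam := mul_le_mul_of_nonneg_left h hn1
  have hV' : ∀ z i, ∑ j, |(fun z => (bDiv M n (fun ν x => (n : ℝ) • ((1 : Matrix ι ι ℝ) - T ν x)) z)ᵀ) z i j| ≤ ((d : ℝ) + 1) * (n : ℝ) * ((n : ℝ) * lam) := fun z i => cols_bDiv_le M n (fun ν x => (n : ℝ) • ((1 : Matrix ι ι ℝ) - T ν x)) hWlam z i
  have hSD := hasMaj_sDiag_if M n L k (fun z => (bDiv M n (fun ν x => (n : ℝ) • ((1 : Matrix ι ι ℝ) - T ν x)) z)ᵀ) (by positivity) hV'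
  have hCT := hasMaj_bContr_transpose_if M n L k (fun ν x => (n : ℝ) • ((1 : Matrix ι ι ℝ) - T ν x)) (by positivity) hWc
  -- word 1: `[G′(1)∂ᵀ]·B`, `B = ∂ − D_T = −(D_T − ∂)`
  have hB : HasMaj (BlockNorm.ofBlocks (unitTorusGeo L k M) (liftBlk (blockOf n M) ι)) (BlockNorm.ofBlocks (unitTorusGeo L k M) (liftBlk (fun b : Tor (fine n M) × Fin (d + 1) => blockOf n M b.1) ι)) (Matrix.mulVecLin ((cgrad M n (fun (_ : Fin (d + 1)) (_ : Tor (fine n M)) => (1 : Matrix ι ι ℝ))) - cgrad M n T)) (fun y y' => (n : ℝ) * ρ * Real.exp δ * Real.exp (-(δ * tdistT M y y'))) := by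
    rw [show (cgrad M n (fun (_ : Fin (d + 1)) (_ : Tor (fine n M)) => (1 : Matrix ι ι ℝ))) - cgrad M n T = -(cgrad M n T - (cgrad M n (fun (_ : Fin (d + 1)) (_ : Tor (fine n M)) => (1 : Matrix ι ι ℝ)))) from (neg_sub _ _).symm, mulVecLin_neg']
    exact hDD.neg
  have hBs : HasMaj (BlockNorm.ofBlocks (unitTorusGeo L k M) (liftBlk (blockOf n M) ι)) (BlockNorm.ofBlocks (unitTorusGeo L k M) (liftBlk (fun b : Tor (fine n M) × Fin (d + 1) => blockOf n M b.1) ι)) (Matrix.mulVecLin ((cgrad M n (fun (_ : Fin (d + 1)) (_ : Tor (fine n M)) => (1 : Matrix ι ι ℝ))) - cgrad M n T)) (fun y y' => (n : ℝ) * ρ * Real.exp (δ + s) * Real.exp (-((δ + s) * tdistT M y y'))) := by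
    rw [show (cgrad M n (fun (_ : Fin (d + 1)) (_ : Tor (fine n M)) => (1 : Matrix ι ι ℝ))) - cgrad M n T = -(cgrad M n T - (cgrad M n (fun (_ : Fin (d + 1)) (_ : Tor (fine n M)) => (1 : Matrix ι ι ℝ)))) from (neg_sub _ _).symm, mulVecLin_neg']
    exact hDDs.neg
  have hBts : HasMaj (BlockNorm.ofBlocks (unitTorusGeo L k M) (liftBlk (fun b : Tor (fine n M) × Fin (d + 1) => blockOf n M b.1) ι)) (BlockNorm.ofBlocks (unitTorusGeo L k M) (liftBlk (blockOf n M) ι)) (Matrix.mulVecLin ((cgrad M n (fun (_ : Fin (d + 1)) (_ : Tor (fine n M)) => (1 : Matrix ι ι ℝ))) - cgrad M n T)ᵀ) (fun y y' => (n : ℝ) * ((d + 1 : ℕ) * ρ) * Real.exp (δ + s) * Real.exp (-((δ + s) * tdistT M y y'))) := by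
    rw [show (cgrad M n (fun (_ : Fin (d + 1)) (_ : Tor (fine n M)) => (1 : Matrix ι ι ℝ))) - cgrad M n T = -(cgrad M n T - (cgrad M n (fun (_ : Fin (d + 1)) (_ : Tor (fine n M)) => (1 : Matrix ι ι ℝ)))) from (neg_sub _ _).symm, Matrix.transpose_neg, mulVecLin_neg']
    exact hDDts.neg
  have hk1 : HasMaj (BlockNorm.ofBlocks (unitTorusGeo L k M) (liftBlk (blockOf n M) ι)) (BlockNorm.ofBlocks (unitTorusGeo L k M) (liftBlk (blockOf n M) ι)) (Matrix.mulVecLin ((cGreen M n (fun (_ : Fin (d + 1)) (_ : Tor (fine n M)) => (1 : Matrix ι ι ℝ)) a) * (cgrad M n (fun (_ : Fin (d + 1)) (_ : Tor (fine n M)) => (1 : Matrix ι ι ℝ)))ᵀ * ((cgrad M n (fun (_ : Fin (d + 1)) (_ : Tor (fine n M)) => (1 : Matrix ι ι ℝ))) - cgrad M n T)))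
      (fun y y' => (BlockNorm.ofBlocks (unitTorusGeo L k M) (liftBlk (blockOf n M) ι)).κ * CA * ((n : ℝ) * ρ * Real.exp δ) * c * Real.exp (-((δ - s) * tdistT M y y'))) := by
    rw [Matrix.mulVecLin_mul]
    exact hasMaj_comp_exp (ρ := δ - s) htri hd hrow hCA (by positivity) (by linarith) (by linarith) (by linarith) hA1 hB
  -- word 2: `G′(1)·Bᵀ∂ = G′(1)·𝔰_{V′} − [G′(1)∂ᵀ]·ℭ_Wᵀ` (transposed Leibniz)
  have hTL : Matrix.mulVecLin ((cgrad M n (fun (_ : Fin (d + 1)) (_ : Tor (fine n M)) => (1 : Matrix ι ι ℝ))) - cgrad M n T)ᵀ ∘ₗ Matrix.mulVecLin (cgrad M n (fun (_ : Fin (d + 1)) (_ : Tor (fine n M)) => (1 : Matrix ι ι ℝ))) =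
      Matrix.mulVecLin (sDiag M n (fun z => (bDiv M n (fun ν x => (n : ℝ) • ((1 : Matrix ι ι ℝ) - T ν x)) z)ᵀ)) - Matrix.mulVecLin (cgrad M n (fun (_ : Fin (d + 1)) (_ : Tor (fine n M)) => (1 : Matrix ι ι ℝ)))ᵀ ∘ₗ Matrix.mulVecLin (bContr M n (fun ν x => (n : ℝ) • ((1 : Matrix ι ι ℝ) - T ν x)))ᵀ := by
    refine LinearMap.ext fun f => ?_
    simp only [LinearMap.comp_apply, LinearMap.sub_apply, Matrix.mulVecLin_apply, cgrad_one_sub_eq_bMulShift]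
    exact bMulShift_transpose_mulVec_cgrad_one M n (fun ν x => (n : ℝ) • ((1 : Matrix ι ι ℝ) - T ν x)) f
  have hk2 : HasMaj (BlockNorm.ofBlocks (unitTorusGeo L k M) (liftBlk (blockOf n M) ι)) (BlockNorm.ofBlocks (unitTorusGeo L k M) (liftBlk (blockOf n M) ι)) (Matrix.mulVecLin ((cGreen M n (fun (_ : Fin (d + 1)) (_ : Tor (fine n M)) => (1 : Matrix ι ι ℝ)) a) * (((cgrad M n (fun (_ : Fin (d + 1)) (_ : Tor (fine n M)) => (1 : Matrix ι ι ℝ))) - cgrad M n T)ᵀ * (cgrad M n (fun (_ : Fin (d + 1)) (_ : Tor (fine n M)) => (1 : Matrix ι ι ℝ))))))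
      (fun y y' => CG * Real.exp (-(δ * tdistT M y y')) * ((BlockNorm.ofBlocks (unitTorusGeo L k M) (liftBlk (blockOf n M) ι)).κ * (((d : ℝ) + 1) * (n : ℝ) * ((n : ℝ) * lam))) + CA * Real.exp (-(δ * tdistT M y y')) * ((BlockNorm.ofBlocks (unitTorusGeo L k M) (liftBlk (blockOf n M) ι)).κ * ((n : ℝ) * ρ))) := by
    have hA1c : HasMaj (BlockNorm.ofBlocks (unitTorusGeo L k M) (liftBlk (fun b : Tor (fine n M) × Fin (d + 1) => blockOf n M b.1) ι)) (BlockNorm.ofBlocks (unitTorusGeo L k M) (liftBlk (blockOf n M) ι)) (Matrix.mulVecLin (cGreen M n (fun (_ : Fin (d + 1)) (_ : Tor (fine n M)) => (1 : Matrix ι ι ℝ)) a) ∘ₗ Matrix.mulVecLin (cgrad M n (fun (_ : Fin (d + 1)) (_ : Tor (fine n M)) => (1 : Matrix ι ι ℝ)))ᵀ) (fun y y' => CA * Real.exp (-(δ * tdistT M y y'))) := by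
      rw [← Matrix.mulVecLin_mul]; exact hA1
    rw [Matrix.mulVecLin_mul, Matrix.mulVecLin_mul, hTL, LinearMap.comp_sub, ← LinearMap.comp_assoc]
    exact (hasMaj_comp_localRight hG1 hSD fun y y' => by positivity).sub (hasMaj_comp_localRight hA1c hCT fun y y' => by positivity)
  -- word 3: `G′(1)·Bᵀ·B`
  have hBB : HasMaj (BlockNorm.ofBlocks (unitTorusGeo L k M) (liftBlk (blockOf n M) ι)) (BlockNorm.ofBlocks (unitTorusGeo L k M) (liftBlk (blockOf n M) ι)) (Matrix.mulVecLin ((cgrad M n (fun (_ : Fin (d + 1)) (_ : Tor (fine n M)) => (1 : Matrix ι ι ℝ))) - cgrad M n T)ᵀ ∘ₗ Matrix.mulVecLin ((cgrad M n (fun (_ : Fin (d + 1)) (_ : Tor (fine n M)) => (1 : Matrix ι ι ℝ))) - cgrad M n T))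
      (fun y y' => (BlockNorm.ofBlocks (unitTorusGeo L k M) (liftBlk (fun b : Tor (fine n M) × Fin (d + 1) => blockOf n M b.1) ι)).κ * ((n : ℝ) * ((d + 1 : ℕ) * ρ) * Real.exp (δ + s)) * ((n : ℝ) * ρ * Real.exp (δ + s)) * c * Real.exp (-(δ * tdistT M y y'))) :=
    hasMaj_comp_exp (ρ := δ) htri hd hrow (by positivity) (by positivity) hδ (by linarith) (by linarith) hBts hBs
  have hk3 : HasMaj (BlockNorm.ofBlocks (unitTorusGeo L k M) (liftBlk (blockOf n M) ι)) (BlockNorm.ofBlocks (unitTorusGeo L k M) (liftBlk (blockOf n M) ι)) (Matrix.mulVecLin ((cGreen M n (fun (_ : Fin (d + 1)) (_ : Tor (fine n M)) => (1 : Matrix ι ι ℝ)) a) * (((cgrad M n (fun (_ : Fin (d + 1)) (_ : Tor (fine n M)) => (1 : Matrix ι ι ℝ))) - cgrad M n T)ᵀ * ((cgrad M n (fun (_ : Fin (d + 1)) (_ : Tor (fine n M)) => (1 : Matrix ι ι ℝ))) - cgrad M n T))))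
      (fun y y' => (BlockNorm.ofBlocks (unitTorusGeo L k M) (liftBlk (blockOf n M) ι)).κ * CG * ((BlockNorm.ofBlocks (unitTorusGeo L k M) (liftBlk (fun b : Tor (fine n M) × Fin (d + 1) => blockOf n M b.1) ι)).κ * ((n : ℝ) * ((d + 1 : ℕ) * ρ) * Real.exp (δ + s)) * ((n : ℝ) * ρ * Real.exp (δ + s)) * c) * c * Real.exp (-((δ - s) * tdistT M y y'))) := by
    rw [Matrix.mulVecLin_mul, Matrix.mulVecLin_mul]
    exact hasMaj_comp_exp (ρ := δ - s) htri hd hrow hCG (by rw [hκV]; positivity) (by linarith) (by linarith) (by linarith) hG1 hBB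
  -- word 4: the averaging words (as n15-c∕215)
  have hk4a : HasMaj (BlockNorm.ofBlocks (unitTorusGeo L k M) (liftBlk (blockOf n M) ι)) (BlockNorm.ofBlocks (unitTorusGeo L k M) (liftBlk (blockOf n M) ι)) (Matrix.mulVecLin ((cGreen M n (fun (_ : Fin (d + 1)) (_ : Tor (fine n M)) => (1 : Matrix ι ι ℝ)) a) * (csavg M n T - csavg M n (fun (_ : Fin (d + 1)) (_ : Tor (fine n M)) => (1 : Matrix ι ι ℝ)))ᵀ * csavg M n T))
      (fun y y' => CG * Real.exp (-(δ * tdistT M y y')) * ((BlockNorm.ofBlocks (unitTorusGeo L k M) (liftBlk (blockOf n M) ι)).κ * (((n : ℝ) ^ (d + 1))⁻¹ * σ * ((BlockNorm.ofBlocks (unitTorusGeo L k M) (liftBlk (fun y : Tor M => y) ι)).κ * τ)))) := by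
    rw [Matrix.mulVecLin_mul, Matrix.mulVecLin_mul]
    have hinner := hasMaj_comp_localRight hQQt hQ fun y y' => by positivity
    have hinner' : HasMaj (BlockNorm.ofBlocks (unitTorusGeo L k M) (liftBlk (blockOf n M) ι)) (BlockNorm.ofBlocks (unitTorusGeo L k M) (liftBlk (blockOf n M) ι)) (Matrix.mulVecLin (csavg M n T - csavg M n (fun (_ : Fin (d + 1)) (_ : Tor (fine n M)) => (1 : Matrix ι ι ℝ)))ᵀ ∘ₗ Matrix.mulVecLin (csavg M n T))
        (fun y y' => if y = y' then ((n : ℝ) ^ (d + 1))⁻¹ * σ * ((BlockNorm.ofBlocks (unitTorusGeo L k M) (liftBlk (fun y : Tor M => y) ι)).κ * τ) else 0) :=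
      hinner.mono fun y y' => by split_ifs <;> simp
    rw [LinearMap.comp_assoc]
    exact hasMaj_comp_localRight hG1 hinner' fun y y' => by positivity
  have hk4b : HasMaj (BlockNorm.ofBlocks (unitTorusGeo L k M) (liftBlk (blockOf n M) ι)) (BlockNorm.ofBlocks (unitTorusGeo L k M) (liftBlk (blockOf n M) ι)) (Matrix.mulVecLin ((cGreen M n (fun (_ : Fin (d + 1)) (_ : Tor (fine n M)) => (1 : Matrix ι ι ℝ)) a) * (csavg M n (fun (_ : Fin (d + 1)) (_ : Tor (fine n M)) => (1 : Matrix ι ι ℝ)))ᵀ * (csavg M n T - csavg M n (fun (_ : Fin (d + 1)) (_ : Tor (fine n M)) => (1 : Matrix ι ι ℝ)))))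
      (fun y y' => CG * Real.exp (-(δ * tdistT M y y')) * ((BlockNorm.ofBlocks (unitTorusGeo L k M) (liftBlk (blockOf n M) ι)).κ * (((n : ℝ) ^ (d + 1))⁻¹ * 1 * ((BlockNorm.ofBlocks (unitTorusGeo L k M) (liftBlk (fun y : Tor M => y) ι)).κ * σ)))) := by
    rw [Matrix.mulVecLin_mul, Matrix.mulVecLin_mul]
    have hinner := hasMaj_comp_localRight hQ1t hQQ fun y y' => by positivity
    have hinner' : HasMaj (BlockNorm.ofBlocks (unitTorusGeo L k M) (liftBlk (blockOf n M) ι)) (BlockNorm.ofBlocks (unitTorusGeo L k M) (liftBlk (blockOf n M) ι)) (Matrix.mulVecLin (csavg M n (fun (_ : Fin (d + 1)) (_ : Tor (fine n M)) => (1 : Matrix ι ι ℝ)))ᵀ ∘ₗ Matrix.mulVecLin (csavg M n T - csavg M n (fun (_ : Fin (d + 1)) (_ : Tor (fine n M)) => (1 : Matrix ι ι ℝ))))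
        (fun y y' => if y = y' then ((n : ℝ) ^ (d + 1))⁻¹ * 1 * ((BlockNorm.ofBlocks (unitTorusGeo L k M) (liftBlk (fun y : Tor M => y) ι)).κ * σ) else 0) :=
      hinner.mono fun y y' => by split_ifs <;> simp
    rw [LinearMap.comp_assoc]
    exact hasMaj_comp_localRight hG1 hinner' fun y y' => by positivity
  -- `K′` assembled
  set θK : ℝ := CA * ((n : ℝ) * ρ * Real.exp δ) * c + CG * (((d : ℝ) + 1) * (n : ℝ) * ((n : ℝ) * lam)) + CA * ((n : ℝ) * ρ)
        + CG * (((n : ℝ) * ((d + 1 : ℕ) * ρ) * Real.exp (δ + s)) * ((n : ℝ) * ρ * Real.exp (δ + s)) * c) * c + |a| * (((n : ℝ) ^ (d + 1))⁻¹ * CG * (σ * τ + σ)) with hθK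
  have hθK0 : 0 ≤ θK := by positivity
  have hKmat : (cGreen M n (fun (_ : Fin (d + 1)) (_ : Tor (fine n M)) => (1 : Matrix ι ι ℝ)) a) * (claplA M n (fun (_ : Fin (d + 1)) (_ : Tor (fine n M)) => (1 : Matrix ι ι ℝ)) a - claplA M n T a) =
      (cGreen M n (fun (_ : Fin (d + 1)) (_ : Tor (fine n M)) => (1 : Matrix ι ι ℝ)) a) * (cgrad M n (fun (_ : Fin (d + 1)) (_ : Tor (fine n M)) => (1 : Matrix ι ι ℝ)))ᵀ * ((cgrad M n (fun (_ : Fin (d + 1)) (_ : Tor (fine n M)) => (1 : Matrix ι ι ℝ))) - cgrad M n T) + (cGreen M n (fun (_ : Fin (d + 1)) (_ : Tor (fine n M)) => (1 : Matrix ι ι ℝ)) a) * (((cgrad M n (fun (_ : Fin (d + 1)) (_ : Tor (fine n M)) => (1 : Matrix ι ι ℝ))) - cgrad M n T)ᵀ * (cgrad M n (fun (_ : Fin (d + 1)) (_ : Tor (fine n M)) => (1 : Matrix ι ι ℝ)))) - (cGreen M n (fun (_ : Fin (d + 1)) (_ : Tor (fine n M)) => (1 : Matrix ι ι ℝ)) a)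 * (((cgrad M n (fun (_ : Fin (d + 1)) (_ : Tor (fine n M)) => (1 : Matrix ι ι ℝ))) - cgrad M n T)ᵀ * ((cgrad M n (fun (_ : Fin (d + 1)) (_ : Tor (fine n M)) => (1 : Matrix ι ι ℝ))) - cgrad M n T))
        - a • ((cGreen M n (fun (_ : Fin (d + 1)) (_ : Tor (fine n M)) => (1 : Matrix ι ι ℝ)) a) * (csavg M n T - csavg M n (fun (_ : Fin (d + 1)) (_ : Tor (fine n M)) => (1 : Matrix ι ι ℝ)))ᵀ * csavg M n T) - a • ((cGreen M n (fun (_ : Fin (d + 1)) (_ : Tor (fine n M)) => (1 : Matrix ι ι ℝ)) a) * (csavg M n (fun (_ : Fin (d + 1)) (_ : Tor (fine n M)) => (1 : Matrix ι ι ℝ)))ᵀ * (csavg M n T - csavg M n (fun (_ : Fin (d + 1)) (_ : Tor (fine n M)) => (1 : Matrix ι ι ℝ)))) := by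
    rw [claplA_one_sub_claplA]
    have hQ' : (csavg M n (fun (_ : Fin (d + 1)) (_ : Tor (fine n M)) => (1 : Matrix ι ι ℝ)))ᵀ * csavg M n (fun (_ : Fin (d + 1)) (_ : Tor (fine n M)) => (1 : Matrix ι ι ℝ)) - (csavg M n T)ᵀ * csavg M n T =
        -((csavg M n T - csavg M n (fun (_ : Fin (d + 1)) (_ : Tor (fine n M)) => (1 : Matrix ι ι ℝ)))ᵀ * csavg M n T + (csavg M n (fun (_ : Fin (d + 1)) (_ : Tor (fine n M)) => (1 : Matrix ι ι ℝ)))ᵀ * (csavg M n T - csavg M n (fun (_ : Fin (d + 1)) (_ : Tor (fine n M)) => (1 : Matrix ι ι ℝ)))) := by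
      rw [Matrix.transpose_sub, Matrix.sub_mul, Matrix.mul_sub]; abel
    rw [hQ']
    simp only [Matrix.mul_add, Matrix.mul_sub, Matrix.mul_smul, Matrix.mul_neg, smul_add, Matrix.mul_assoc, smul_neg]
    abel
  have hK : HasMaj (BlockNorm.ofBlocks (unitTorusGeo L k M) (liftBlk (blockOf n M) ι)) (BlockNorm.ofBlocks (unitTorusGeo L k M) (liftBlk (blockOf n M) ι)) (Matrix.mulVecLin ((cGreen M n (fun (_ : Fin (d + 1)) (_ : Tor (fine n M)) => (1 : Matrix ι ι ℝ)) a) * (claplA M n (fun (_ : Fin (d + 1)) (_ : Tor (fine n M)) => (1 : Matrix ι ι ℝ)) a - claplA M n T a))) (fun y y' => θK * Real.exp (-((δ - s) * tdistT M y y'))) := by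
    rw [hKmat, mulVecLin_sub', mulVecLin_sub', mulVecLin_sub', Matrix.mulVecLin_add, mulVecLin_smul', mulVecLin_smul']
    have hk2' : HasMaj (BlockNorm.ofBlocks (unitTorusGeo L k M) (liftBlk (blockOf n M) ι)) (BlockNorm.ofBlocks (unitTorusGeo L k M) (liftBlk (blockOf n M) ι)) (Matrix.mulVecLin ((cGreen M n (fun (_ : Fin (d + 1)) (_ : Tor (fine n M)) => (1 : Matrix ι ι ℝ)) a) * (((cgrad M n (fun (_ : Fin (d + 1)) (_ : Tor (fine n M)) => (1 : Matrix ι ι ℝ))) - cgrad M n T)ᵀ * (cgrad M n (fun (_ : Fin (d + 1)) (_ : Tor (fine n M)) => (1 : Matrix ι ι ℝ))))))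
        (fun y y' => (CG * (((d : ℝ) + 1) * (n : ℝ) * ((n : ℝ) * lam)) + CA * ((n : ℝ) * ρ)) * Real.exp (-((δ - s) * tdistT M y y'))) := by
      refine (hk2.mono fun y y' => le_of_eq (by rw [hκS]; ring)).of_rate_le hd (by positivity) (by linarith : δ - s ≤ δ)
    have hk4a' := (hasMaj_smul_ofBlocks (g := unitTorusGeo L k M) (liftBlk (blockOf n M) ι) (K := fun y y' => (CG * (((n : ℝ) ^ (d + 1))⁻¹ * σ * τ)) * Real.exp (-((δ - s) * tdistT M y y')))
      (fun y y' => by positivity) a ((hk4a.mono fun y y' => le_of_eq (by rw [hκS, hκC]; ring)).of_rate_le hd (by positivity) (by linarith : δ - s ≤ δ)))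
    have hk4b' := (hasMaj_smul_ofBlocks (g := unitTorusGeo L k M) (liftBlk (blockOf n M) ι) (K := fun y y' => (CG * (((n : ℝ) ^ (d + 1))⁻¹ * σ)) * Real.exp (-((δ - s) * tdistT M y y')))
      (fun y y' => by positivity) a ((hk4b.mono fun y y' => le_of_eq (by rw [hκS, hκC]; ring)).of_rate_le hd (by positivity) (by linarith : δ - s ≤ δ)))
    refine ((((hk1.add hk2').sub hk3).sub hk4a').sub hk4b').mono fun y y' => le_of_eq ?_
    rw [hθK, hκS, hκV]
    ring
  -- the fixed point `G′(T) = G′(1) + K′·G′(T)` and the a-priori bound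
  have hfix : Matrix.mulVecLin (cGreen M n T a) = Matrix.mulVecLin (cGreen M n (fun (_ : Fin (d + 1)) (_ : Tor (fine n M)) => (1 : Matrix ι ι ℝ)) a) + Matrix.mulVecLin ((cGreen M n (fun (_ : Fin (d + 1)) (_ : Tor (fine n M)) => (1 : Matrix ι ι ℝ)) a) * (claplA M n (fun (_ : Fin (d + 1)) (_ : Tor (fine n M)) => (1 : Matrix ι ι ℝ)) a - claplA M n T a)) ∘ₗ Matrix.mulVecLin (cGreen M n T a) := by
    rw [← Matrix.mulVecLin_mul, ← Matrix.mulVecLin_add]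
    refine congrArg Matrix.mulVecLin ?_
    have h := cGreen_sub M n h1unit hT ha
    calc cGreen M n T a = (cGreen M n (fun (_ : Fin (d + 1)) (_ : Tor (fine n M)) => (1 : Matrix ι ι ℝ)) a) - ((cGreen M n (fun (_ : Fin (d + 1)) (_ : Tor (fine n M)) => (1 : Matrix ι ι ℝ)) a) - cGreen M n T a) := (sub_sub_cancel _ _).symm
      _ = (cGreen M n (fun (_ : Fin (d + 1)) (_ : Tor (fine n M)) => (1 : Matrix ι ι ℝ)) a) - (cGreen M n (fun (_ : Fin (d + 1)) (_ : Tor (fine n M)) => (1 : Matrix ι ι ℝ)) a) * (claplA M n T a - claplA M n (fun (_ : Fin (d + 1)) (_ : Tor (fine n M)) => (1 : Matrix ι ι ℝ)) a) * cGreen M n T a := by rw [h]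
      _ = (cGreen M n (fun (_ : Fin (d + 1)) (_ : Tor (fine n M)) => (1 : Matrix ι ι ℝ)) a) + (cGreen M n (fun (_ : Fin (d + 1)) (_ : Tor (fine n M)) => (1 : Matrix ι ι ℝ)) a) * (claplA M n (fun (_ : Fin (d + 1)) (_ : Tor (fine n M)) => (1 : Matrix ι ι ℝ)) a - claplA M n T a) * cGreen M n T a := by
          rw [show claplA M n (fun (_ : Fin (d + 1)) (_ : Tor (fine n M)) => (1 : Matrix ι ι ℝ)) a - claplA M n T a = -(claplA M n T a - claplA M n (fun (_ : Fin (d + 1)) (_ : Tor (fine n M)) => (1 : Matrix ι ι ℝ)) a) from (neg_sub _ _).symm, Matrix.mul_neg, Matrix.neg_mul, sub_eq_add_neg]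
  obtain ⟨M₀, hM₀, hap⟩ := exists_const_hasMaj_ofBlocks (g := unitTorusGeo L k M) (liftBlk (blockOf n M) ι) (liftBlk (blockOf n M) ι) (Matrix.mulVecLin (cGreen M n T a))
  have hq' : (BlockNorm.ofBlocks (unitTorusGeo L k M) (liftBlk (blockOf n M) ι)).κ * θK * c < 1 := by rw [hκS, one_mul]; exact hq
  have hS := hG1.of_rate_le hd hCG (by linarith : δ - 2 * s ≤ δ)
  have key := neumann_majorant (b₁ := (BlockNorm.ofBlocks (unitTorusGeo L k M) (liftBlk (blockOf n M) ι))) (b₂ := (BlockNorm.ofBlocks (unitTorusGeo L k M) (liftBlk (blockOf n M) ι))) (ρ := δ - 2 * s) htri hd hrow hθK0 hCG hM₀ (by linarith) (by linarith) hK hS hfix hap hq'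
  refine key.mono fun y y' => le_of_eq ?_
  rw [hκS, one_mul]

end Green

end Summit.QuantumFields.YangMills.BalabanUVNodes.N15.CovLandau

end
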